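import Summits.RiemannHypothesis.RiemannHypothesis.Theorems.SignConeConeMagnificationTrivialDesignUnitSlack
import Summits.RiemannHypothesis.RiemannHypothesis.Theorems.SignConeConeMagnificationDirichletAbel
import Summits.RiemannHypothesis.RiemannHypothesis.Theorems.SignConeConeMagnificationStubFakeMertens
import Literature.NumberTheory.LFunctions.RosserSchoenfeldMertensFirstConstantCorollaries

/-!
# Crux `SignCone.ConeMagnification` (stmt-RiemannHypothesis-16303), line `Sketch` r8:
# THE TRIVIAL TYPE INEQUALITY `T(δ₁) ≤ 0.49 < 1/2` FOR UNIT-SLACK WEIGHTS (kernel-checked, comb-free)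

The `α = δ₁` instance of the conclusion of `stub_combType` — convergence of `Σ_{n ≤ x} (c(n) − Λ(n))/n` to a limit
`T ≤ ½` — PROVED for every unit-slack weight, with the better constant `0.49`:

* `tendsto_LSeries_sub_pole_of_mertens` — Mertens `Σ_{n≤x} c(n)/n − log x → C` and `Σ c n^{-σ} < ∞ (σ > 1)` give
  `Re L_c(σ) − 1/(σ−1) → C` as `σ → 1+` (Abel's theorem `DirichletAbel.abel_dirichlet` for `a(i) = (c(i+1) − 1)/(i+1)`,
  whose partial sums tend to `C − γ`, plus Mathlib's `ζ(σ) − 1/(σ−1) → γ`);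
* `re_apply_one_eq_of_mertens` — hence the continuation `F = L_c − 1/(s−1)` has `Re F(1) = C`;
* `typeIneq_trivialDesign_of_unitSlack` (anchor `trivialTypeIneqOfUnitSlack`) — for `c ≥ 0`, `c 1 = 0` with unit
  slack: `Σ_{n≤x}(c(n) − Λ(n))/n → T` with `T ≤ 49/100` (`T = C + γ = Re F(1) + γ`, bounded by the Harnack file
  `…TrivialDesignHarnack` through `…TrivialDesignUnitSlack`'s chain and `stub_fakeMertens`).
-/

noncomputable section

-- `Summit.RiemannHypothesis.RiemannHypothesis.…` repeats a namespace component by design (D-0017 layout).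
set_option linter.dupNamespace false

open scoped BigOperators Topology
open Complex Set Filter Metric

namespace Summit.RiemannHypothesis.RiemannHypothesis.Theorems.SignConeConeMagnification

open Literature.NumberTheory.LFunctions
open Summit.RiemannHypothesis.RiemannHypothesis.Theorems.SignCone
open Summit.RiemannHypothesis.RiemannHypothesis.Cruxes.ConeMagnification.Sketch (stub_continuation)

namespace TrivialDesign

/-! ### Harmonic sums over `[1, N]` -/

/-- Reindexing `Σ_{i<N} g(i+1) = Σ_{n ∈ [1,N]} g(n)`. [folklore] -/
theorem sum_range_succ_eq_sum_Icc (g : ℕ → ℝ) (N : ℕ) :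
    ∑ i ∈ Finset.range N, g (i + 1) = ∑ n ∈ Finset.Icc 1 N, g n := by
  induction N with
  | zero => simp
  | succ N ih => rw [Finset.sum_range_succ, ih, Finset.sum_Icc_succ_top (by omega)]

/-- `Σ_{n ≤ N} 1/n − log N → γ`. [folklore] -/
theorem tendsto_harmonic_Icc_sub_log :
    Tendsto (fun N : ℕ => (∑ n ∈ Finset.Icc 1 N, 1 / (n : ℝ)) - Real.log N) atTop
      (𝓝 Real.eulerMascheroniConstant) := by
  have h := Real.tendsto_eulerMascheroniSeq'
  refine (h.congr' ?_)
  filter_upwards [eventually_ne_atTop 0] with N hN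
  rw [Real.eulerMascheroniSeq', if_neg hN, harmonic_eq_sum_Icc]
  push_cast
  congr 1
  exact Finset.sum_congr rfl fun n _ => by rw [one_div]

/-! ### Abel: the Mertens constant is `lim_{σ→1+} (Re L_c(σ) − 1/(σ−1))` -/

/-- **Mertens constant as an Abelian limit.**  For real `c` with `Σ c(n) n^{-σ} < ∞` (`σ > 1`) and
`Σ_{n ≤ x} c(n)/n − log x → C`: `Re L_c(σ) − 1/(σ−1) → C` as `σ → 1+`. [folklore] -/
theorem tendsto_LSeries_sub_pole_of_mertens (c : ℕ → ℝ)
    (hsum : ∀ σ : ℝ, 1 < σ → LSeriesSummable (fun n => ((c n : ℝ) : ℂ)) σ) {C : ℝ}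
    (hM : Tendsto (fun x : ℝ => (∑ n ∈ Finset.Icc 1 ⌊x⌋₊, c n / n) - Real.log x) atTop (𝓝 C)) :
    Tendsto (fun σ : ℝ => (LSeries (fun n => ((c n : ℝ) : ℂ)) σ).re - 1 / (σ - 1)) (𝓝[>] 1) (𝓝 C) := by
  set a : ℕ → ℝ := fun i => (c (i + 1) - 1) / ((i : ℝ) + 1) with ha
  -- partial sums of `a` tend to `C − γ`
  have hG : Tendsto (fun N : ℕ => ∑ i ∈ Finset.range N, a i) atTop (𝓝 (C - Real.eulerMascheroniConstant)) := by
    have h1 : Tendsto (fun N : ℕ => (∑ n ∈ Finset.Icc 1 N, c n / n) - Real.log N) atTop (𝓝 C) := by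
      have := hM.comp tendsto_natCast_atTop_atTop
      refine this.congr fun N => ?_
      simp only [Function.comp_apply, Nat.floor_natCast]
    have h2 := tendsto_harmonic_Icc_sub_log
    refine (h1.sub h2).congr fun N => ?_
    have : ∑ i ∈ Finset.range N, a i = ∑ n ∈ Finset.Icc 1 N, (c n - 1) / (n : ℝ) := by
      rw [← sum_range_succ_eq_sum_Icc]
      refine Finset.sum_congr rfl fun i _ => ?_
      simp only [ha, Nat.cast_add, Nat.cast_one]
    rw [this, sub_sub_sub_cancel_right, ← Finset.sum_sub_distrib]
    exact Finset.sum_congr rfl fun n _ => by rw [sub_div]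
  -- the terms at `u > 0`: `a(i)(i+1)^{-u} = c(i+1)/(i+1)^{1+u} − 1/(i+1)^{1+u}`
  have hterm : ∀ u : ℝ, ∀ i : ℕ, a i * ((i : ℝ) + 1) ^ (-u) =
      c (i + 1) / ((i : ℝ) + 1) ^ (1 + u) - 1 / ((i : ℝ) + 1) ^ (1 + u) := by
    intro u i
    have hi : (0 : ℝ) < (i : ℝ) + 1 := by positivity
    simp only [ha]
    rw [Real.rpow_add hi, Real.rpow_one, Real.rpow_neg hi.le]
    field_simp
  -- real parts of `L_c` and `ζ` at `1 + u`
  have hLre : ∀ u : ℝ, 0 < u → (LSeries (fun n => ((c n : ℝ) : ℂ)) ((1 + u : ℝ) : ℂ)).re =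
      ∑' i : ℕ, c (i + 1) / ((i : ℝ) + 1) ^ (1 + u) ∧ Summable (fun i : ℕ => c (i + 1) / ((i : ℝ) + 1) ^ (1 + u)) := by
    intro u hu
    obtain ⟨h1, hs1⟩ := re_LSeries_ofReal c (by linarith : (1 : ℝ) < 1 + u) (hsum _ (by linarith))
    have hshift := hs1.tsum_eq_zero_add
    simp only [Nat.cast_zero, Real.zero_rpow (by linarith : (1 + u : ℝ) ≠ 0), div_zero, zero_add,
      Nat.cast_add, Nat.cast_one] at hshift
    refine ⟨by rw [h1, hshift], ?_⟩
    have := (summable_nat_add_iff 1).2 hs1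
    simpa only [Nat.cast_add, Nat.cast_one] using this
  have hZre : ∀ u : ℝ, 0 < u → (riemannZeta ((1 + u : ℝ) : ℂ)).re =
      ∑' i : ℕ, 1 / ((i : ℝ) + 1) ^ (1 + u) ∧ Summable (fun i : ℕ => 1 / ((i : ℝ) + 1) ^ (1 + u)) := by
    intro u hu
    have h1u : (1 : ℝ) < 1 + u := by linarith
    have hre1 : 1 < (((1 + u : ℝ) : ℂ)).re := by simpa using h1u
    have hsR : Summable (fun n : ℕ => 1 / (n : ℝ) ^ (1 + u)) := Real.summable_one_div_nat_rpow.2 h1u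
    have hzeta : riemannZeta ((1 + u : ℝ) : ℂ) = ∑' n : ℕ, 1 / (n : ℂ) ^ (((1 + u : ℝ) : ℂ)) :=
      zeta_eq_tsum_one_div_nat_cpow hre1
    have hterm1 : ∀ n : ℕ, (1 : ℂ) / (n : ℂ) ^ (((1 + u : ℝ) : ℂ)) = ((1 / (n : ℝ) ^ (1 + u) : ℝ) : ℂ) := by
      intro n
      rw [Complex.ofReal_div, Complex.ofReal_one, Complex.ofReal_cpow (Nat.cast_nonneg n)]
      simp
    have hre : (riemannZeta ((1 + u : ℝ) : ℂ)).re = ∑' n : ℕ, 1 / (n : ℝ) ^ (1 + u) := by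
      rw [hzeta, tsum_congr hterm1, ← Complex.ofReal_tsum, Complex.ofReal_re]
    have hshift := hsR.tsum_eq_zero_add
    simp only [Nat.cast_zero, Real.zero_rpow (by linarith : (1 + u : ℝ) ≠ 0), div_zero, zero_add,
      Nat.cast_add, Nat.cast_one] at hshift
    refine ⟨by rw [hre, hshift], ?_⟩
    have := (summable_nat_add_iff 1).2 hsR
    simpa only [Nat.cast_add, Nat.cast_one] using this
  -- summability of `a(i)(i+1)^{-u}` and the value of its sum
  have hs : ∀ u : ℝ, 0 < u → Summable (fun i : ℕ => a i * ((i : ℝ) + 1) ^ (-u)) := by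
    intro u hu
    have := ((hLre u hu).2.sub (hZre u hu).2)
    exact this.congr fun i => (hterm u i).symm
  have hval : ∀ u : ℝ, 0 < u → ∑' i : ℕ, a i * ((i : ℝ) + 1) ^ (-u) =
      (LSeries (fun n => ((c n : ℝ) : ℂ)) ((1 + u : ℝ) : ℂ)).re - (riemannZeta ((1 + u : ℝ) : ℂ)).re := by
    intro u hu
    rw [(hLre u hu).1, (hZre u hu).1, ← ((hLre u hu).2.tsum_sub (hZre u hu).2)]
    exact tsum_congr fun i => hterm u i
  -- Abel + `ζ(1+u) − 1/u → γ`
  have hA := DirichletAbel.abel_dirichlet hG hs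
  have hZ : Tendsto (fun u : ℝ => (riemannZeta ((1 + u : ℝ) : ℂ)).re - 1 / u) (𝓝[>] 0)
      (𝓝 Real.eulerMascheroniConstant) := by
    have h1 := ZetaAsymptotics.tendsto_riemannZeta_sub_one_div_nhds_right
    have h2 : Tendsto (fun u : ℝ => 1 + u) (𝓝[>] (0 : ℝ)) (𝓝[>] 1) := by
      refine tendsto_nhdsWithin_iff.2 ⟨?_, ?_⟩
      · have : Tendsto (fun u : ℝ => 1 + u) (𝓝 0) (𝓝 (1 + 0)) := tendsto_const_nhds.add tendsto_id
        rw [add_zero] at this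
        exact this.mono_left nhdsWithin_le_nhds
      · filter_upwards [self_mem_nhdsWithin] with u hu
        simp only [Set.mem_Ioi] at hu ⊢
        linarith
    have h3 : Tendsto (fun u : ℝ => (riemannZeta ((1 + u : ℝ) : ℂ) - 1 / (((1 + u : ℝ) : ℂ) - 1)).re)
        (𝓝[>] 0) (𝓝 ((Real.eulerMascheroniConstant : ℂ)).re) :=
      (Complex.continuous_re.tendsto _).comp (h1.comp h2)
    rw [Complex.ofReal_re] at h3
    refine h3.congr' ?_
    filter_upwards [self_mem_nhdsWithin] with u hu
    have : ((1 + u : ℝ) : ℂ) - 1 = ((u : ℝ) : ℂ) := by push_cast; ring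
    rw [Complex.sub_re, this, ← Complex.ofReal_one, ← Complex.ofReal_div, Complex.ofReal_re]
  have hsum' := hA.add hZ
  rw [sub_add_cancel] at hsum'
  -- back to `σ = 1 + u`
  have h4 : Tendsto (fun σ : ℝ => σ - 1) (𝓝[>] (1 : ℝ)) (𝓝[>] 0) := by
    refine tendsto_nhdsWithin_iff.2 ⟨?_, ?_⟩
    · have : Tendsto (fun σ : ℝ => σ - 1) (𝓝 1) (𝓝 (1 - 1)) := tendsto_id.sub tendsto_const_nhds
      rw [sub_self] at this
      exact this.mono_left nhdsWithin_le_nhds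
    · filter_upwards [self_mem_nhdsWithin] with σ hσ
      simp only [Set.mem_Ioi] at hσ ⊢
      linarith
  refine ((hsum'.comp h4).congr' ?_)
  filter_upwards [self_mem_nhdsWithin] with σ hσ
  have hu : 0 < σ - 1 := by simpa using hσ
  simp only [Function.comp_apply]
  rw [hval _ hu]
  have e : ((1 + (σ - 1) : ℝ) : ℂ) = (σ : ℂ) := by push_cast; ring
  rw [e]
  ring

/-- **`Re F(1) = C`.**  If `F` is holomorphic on `Re s > 1/2` with `F = L_c − 1/(s−1)` on `Re s > 1`, and `c` has
Mertens constant `C`, then `Re F(1) = C`. [folklore] -/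
theorem re_apply_one_eq_of_mertens (c : ℕ → ℝ)
    (hsum : ∀ σ : ℝ, 1 < σ → LSeriesSummable (fun n => ((c n : ℝ) : ℂ)) σ) {C : ℝ}
    (hM : Tendsto (fun x : ℝ => (∑ n ∈ Finset.Icc 1 ⌊x⌋₊, c n / n) - Real.log x) atTop (𝓝 C))
    (F : ℂ → ℂ) (hFd : DifferentiableOn ℂ F {s : ℂ | 1 / 2 < s.re})
    (hFeq : ∀ s : ℂ, 1 < s.re → F s = LSeries (fun n => ((c n : ℝ) : ℂ)) s - 1 / (s - 1)) :
    (F 1).re = C := by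
  have hlim := tendsto_LSeries_sub_pole_of_mertens c hsum hM
  have hopen : IsOpen {s : ℂ | 1 / 2 < s.re} := isOpen_lt continuous_const Complex.continuous_re
  have h1 : (1 : ℂ) ∈ {s : ℂ | 1 / 2 < s.re} := by
    simp only [Set.mem_setOf_eq, Complex.one_re]
    norm_num
  have hcontF : ContinuousAt F 1 := (hFd.differentiableAt (hopen.mem_nhds h1)).continuousAt
  have hF : Tendsto (fun σ : ℝ => (F σ).re) (𝓝[>] (1 : ℝ)) (𝓝 (F 1).re) := by
    have h2 : Tendsto (fun σ : ℝ => (σ : ℂ)) (𝓝 (1 : ℝ)) (𝓝 (1 : ℂ)) := by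
      have := Complex.continuous_ofReal.tendsto 1
      simpa using this
    have h3 := (Complex.continuous_re.tendsto _).comp (hcontF.tendsto.comp h2)
    exact h3.mono_left nhdsWithin_le_nhds
  have hF' : Tendsto (fun σ : ℝ => (F σ).re) (𝓝[>] (1 : ℝ)) (𝓝 C) := by
    refine hlim.congr' ?_
    filter_upwards [self_mem_nhdsWithin] with σ hσ
    have hσ' : 1 < σ := hσ
    rw [hFeq σ (by simpa using hσ'), Complex.sub_re]
    congr 1
    rw [show (σ : ℂ) - 1 = ((σ - 1 : ℝ) : ℂ) by push_cast; ring, ← Complex.ofReal_one, ← Complex.ofReal_div,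
      Complex.ofReal_re]
  exact tendsto_nhds_unique hF hF'

end TrivialDesign

/-! ### The trivial type inequality for unit-slack weights -/

/-- **The trivial type inequality, kernel-checked: `T(δ₁) ≤ 0.49 < 1/2`.**  For every weight `c ≥ 0`, `c 1 = 0`, with
unit slack against every Weil test, the partial sums `Σ_{n ≤ x} (c(n) − Λ(n))/n` converge to a limit `T ≤ 49/100` —
the `α = δ₁` instance of `stub_combType`'s conclusion (there `T ≤ ½`), by Harnack instead of combs: the landed chain
gives Mertens for `c` (`stub_fakeMertens`) and a Carathéodory description `F`; `T = C + γ = Re F(1) + γ`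
(`TrivialDesign.re_apply_one_eq_of_mertens`) and `Re F(1) + γ ≤ 0.49` (`…TrivialDesignHarnack`). [folklore] -/
theorem typeIneq_trivialDesign_of_unitSlack (c : ℕ → ℝ) (hc0 : ∀ n, 0 ≤ c n) (hc1 : c 1 = 0)
    (hU : ∀ g : ℝ → ℂ, IsWeilTest g →
      -(∫ t, ‖g t‖ ^ 2) ≤
        (weilPolarTerm (weilConv g (weilReflect g)) + weilArchTerm (weilConv g (weilReflect g)) -
          ∑' n : ℕ, ((c n : ℝ) : ℂ) / (Real.sqrt n : ℂ) *
            (weilConv g (weilReflect g) (Real.log n) + weilConv g (weilReflect g) (-Real.log n))).re) :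
    ∃ T : ℝ, Tendsto (fun x : ℝ => ∑ n ∈ Finset.Icc 1 ⌊x⌋₊,
        (c n - ArithmeticFunction.vonMangoldt n) / n) atTop (𝓝 T) ∧ T ≤ 49 / 100 := by
  have hPNT := stub_fakePNT c hc0 hU
  have hsum := stub_chebyshev c hc0 hPNT
  have hcont := stub_continuation c hc0 hPNT hsum
  have hPD := stub_pdLaplace c hc0 hU
  obtain ⟨F, hFd, hFeq, hFle⟩ := stub_cara c hc0 hc1 hU hsum hcont hPD
  obtain ⟨C, hC⟩ := (stub_fakeMertens c hc0 hPNT).2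
  have hbound := TrivialDesign.re_apply_one_add_euler_le c hc0 hc1 hsum F hFd hFeq hFle
  have hF1 := TrivialDesign.re_apply_one_eq_of_mertens c hsum hC F hFd hFeq
  refine ⟨C + Real.eulerMascheroniConstant, ?_, by linarith⟩
  have hΛ := Literature.NumberTheory.LFunctions.tendsto_sum_vonMangoldt_div_sub_log
  have h := hC.sub hΛ
  rw [show C - -Real.eulerMascheroniConstant = C + Real.eulerMascheroniConstant by ring] at h
  refine h.congr fun x => ?_
  have hI : Finset.Icc 1 ⌊x⌋₊ = Finset.Ioc 0 ⌊x⌋₊ := by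
    ext n
    simp only [Finset.mem_Icc, Finset.mem_Ioc]
    omega
  rw [← hI, sub_sub_sub_cancel_right, ← Finset.sum_sub_distrib]
  exact Finset.sum_congr rfl fun n _ => by rw [sub_div]

/-- **Anchor `trivialTypeIneqOfUnitSlack`** (registered sub-goal): the trivial type inequality `T(δ₁) ≤ 49/100` for
unit-slack weights. [folklore] -/
theorem trivialTypeIneqOfUnitSlack : ∀ c : ℕ → ℝ, (∀ n, 0 ≤ c n) → c 1 = 0 →
    (∀ g : ℝ → ℂ, IsWeilTest g →
      -(∫ t, ‖g t‖ ^ 2) ≤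
        (weilPolarTerm (weilConv g (weilReflect g)) + weilArchTerm (weilConv g (weilReflect g)) -
          ∑' n : ℕ, ((c n : ℝ) : ℂ) / (Real.sqrt n : ℂ) *
            (weilConv g (weilReflect g) (Real.log n) + weilConv g (weilReflect g) (-Real.log n))).re) →
    ∃ T : ℝ, Filter.Tendsto (fun x : ℝ => ∑ n ∈ Finset.Icc 1 ⌊x⌋₊,
        (c n - ArithmeticFunction.vonMangoldt n) / n) Filter.atTop (nhds T) ∧ T ≤ 49 / 100 :=
  fun c hc0 hc1 hU => typeIneq_trivialDesign_of_unitSlack c hc0 hc1 hU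

end Summit.RiemannHypothesis.RiemannHypothesis.Theorems.SignConeConeMagnification

end
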